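import Literature.MathematicalPhysics.QuantumLattice.KomaPiFluxGroundStateOrder2D
import Literature.MathematicalPhysics.QuantumLattice.TorusLimitOfMixtures
import Literature.MathematicalPhysics.QuantumLattice.InfVolFermionStateCompactness
import Literature.MathematicalPhysics.QuantumLattice.InfVolFermionStateWeakLimits
import HarnessLib

/-!
# Koma 2022 eqs. (2.13)–(2.15) IN INFINITE VOLUME: the states of the `π`-flux BCS lattice-fermion model obtained
# by the thermodynamic limit under a symmetry-breaking field `B > 0` followed by `B ↘ 0` carry a spontaneous
# superconducting order `|Λ|⁻¹ ω(O^{(Λ)}) ≥ μ > 0` on EVERY finite box `Λ`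

T. Koma, *Nambu–Goldstone modes for superconducting lattice fermions*, arXiv:2201.13135 (2022) [Koma2022], §2,
p. 6: with the finite-volume ground state under the field, `ω^{(Λ)}_{B,g'}(⋯) := lim_{β↗∞} ⟨⋯⟩^{(Λ)}_{β,B}` (2.13),
and `ω_{0,g'}(⋯) := weak*-lim_{B↘0} weak*-lim_{Λ↗ℤ^d} ω^{(Λ)}_{B,g'}(⋯)` (2.14) ("if necessary, we take a
suitable subsequence"), "there appears a spontaneous magnetization in the sense that [33]
`|Λ|⁻¹ ω_{0,g'}(O^{(Λ)}) ≥ μ > 0` (2.15) for a large `Λ`, where `μ` is a positive constant" — [33] = T. Koma,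
H. Tasaki, Commun. Math. Phys. 158 (1993) 191 [KomaTasaki1993], Theorem 7.3.

The finite-volume content of (2.15) is the tree's `KomaPiFlux.spontaneousOrder_of_groundLroSq` /
`KomaPiFlux.spontaneousOrder_coulomb` (`KomaPiFluxSpontaneousOrder.lean`: on all large even tori EVERY unit ground
state `Φ_B` of `H - B·O` has `|Λ|⁻¹ Re Φ_B†OΦ_B ≥ √2σ - ε`).  This file passes to the infinite-volume states of the
CAR algebra over `ℤ^D × {↑,↓}` (`InfVolFermionState D`, `InfVolFermionState.lean`; thermodynamic limits of
translation-averaged torus states `IsTorusLimitOf` / of finite mixtures of torus vectors `IsTorusLimitOfMixture`,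
Bratteli–Robinson I §4.3.1) and proves (2.15) VERBATIM, for every finite region `Λ ⊂ ℤ^D` (not only "for a large
`Λ`": torus limits are translation invariant), with the explicit constant `μ = √2σ`:

* §1 (generic, namespace `PairHopRP`): second quantisation and torus translations of the `η`-pairing densities,
  `Γ(φ)Γ^{±,1,2}_x = Γ^{±,1,2}_{φx}` (`fermionEmbed_gammaPlus/Minus/One/Two`), `T_vΓ^{…}_xT_v⁻¹ = Γ^{…}_{x+v}`
  (`relabel_translate_gammaPlus/Minus/One/Two`), `T_v O T_v⁻¹ = O` (`relabel_translate_orderParameter`).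
* §2 (namespace `KomaPiFlux`): the local order density `localGammaTwo x = Γ²_x ∈ 𝔄_{{x}}` of a site `x ∈ ℤ^D`;
  **`torusAvgExpect_localGammaTwo`**: its translation-averaged expectation in a torus vector `ψ` is
  `|Λ|⁻¹⟨ψ, OΨ⟩`, `O = Σ_yΓ²_y = orderParameter`; `expect_orderParameter_eq_sum`: for every infinite-volume state,
  `ω(O^{(Λ)}) = Σ_{x∈Λ} ω(Γ²_x)` with `O^{(Λ)} = Σ_{x∈Λ}Γ²_x ∈ 𝔄_Λ` (`= PairHopRP.orderParameter` of the region).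
* §3 ENGINE.  `KomaPiFlux.IsSourcedGroundStateLimit κ U g g' B ω` — `ω` is a thermodynamic limit, along even tori
  `(ℤ/2k_jℤ)^D`, `k_j → ∞`, of finite mixtures (probability weights) of unit ground states of
  `H_C(B) = hamiltonianC κ U g g' 0 B` (this covers the vector ground states AND the tracial = zero-temperature-limit
  ground state (2.13), which is the uniform mixture over an orthonormal basis of the ground space);
  `KomaPiFlux.IsInfinitesimalFieldGroundState κ U g g' ω` — Koma's `ω_{0,g'}` (2.14): a weak-⋆ (pointwise on the
  local algebras) limit of sourced ground-state limits `ω_n` at fields `B_n > 0`, `B_n → 0`.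
  **`IsSourcedGroundStateLimit.le_re_expect_localGammaTwo_of_groundLroSq`**: if `groundLroSq H_C(0) ≥ a ∈ (0,1]` on
  all large even tori then `Re ω(Γ²_x) ≥ √(2a)` at every site for every sourced ground-state limit `ω` at any
  `B > 0`; the bound passes to weak-⋆ limits (`IsInfinitesimalFieldGroundState.le_re_expect_localGammaTwo_…`) and sums
  to **`… .boxOrder_ge_of_groundLroSq`**: `√(2a)·|Λ| ≤ Re ω(O^{(Λ)})` for every finite `Λ`.
* §4 KOMA (2.15): **`IsInfinitesimalFieldGroundState.boxOrder_ge_coulomb`** — `D = d+1 ≥ 3`, `g > 0`,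
  `|κ| ≤ g/1000`, `0 ≤ g' ≤ g/2000`, `U + 2gD ≤ 0`: `|Λ|⁻¹ Re ω_{0,g'}(O^{(Λ)}) ≥ 1/√1000` for EVERY finite region
  `Λ` and every state `ω_{0,g'}` of (2.14) (from `groundState_superconductingOrder_coulomb`, `σ² = 1/2000`); the
  two-dimensional zero-temperature edition **`… .boxOrder_ge_two`** (`|κ| ≤ g/2000`, `U + 4g ≤ 0`, floor
  `4/√1000`, from `groundState_superconductingOrder_two`); and NON-VACUITY (the subsequences of (2.14) exist, by the
  tree's weak-⋆ compactness theorems `InfVolFermionState.exists_isTorusLimitOf_subseq`,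
  `InfVolFermionState.exists_tendsto_expect_subseq`): `exists_isSourcedGroundStateLimit`,
  **`exists_isInfinitesimalFieldGroundState`**.
* §5 (2.13) LITERALLY.  `Matrix.exists_groundStateFunctional_eq_average` (general): the tracial ground state
  `ω_GS = tr(P₀·)/tr P₀` of a Hermitian matrix is the uniform mixture over an orthonormal basis of the ground space;
  `torusAvgGroundStateExpect L H Λ A` — the translation-averaged expectation of `A ∈ 𝔄_Λ` in `ω_GS(H)` on the torus
  of side `L`, which IS the `β ↗ ∞` limit (2.13) of the averaged Gibbs expectations (`tendsto_gibbsState_torusAvg`,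
  by the tree's `Matrix.tendsto_gibbsState_atTop_holds`) and is a probability mixture of unit ground states
  uniformly in `(Λ, A)` (`exists_torusAvgGroundStateExpect_eq_mixture`); hence thermodynamic limits of the
  zero-temperature limit states are sourced ground-state limits (`IsSourcedGroundStateLimit.of_zeroTemperature`)
  and **`koma_2_15_coulomb`** states (2.13) → (2.14) → (2.15) end to end with all limits explicit.

Faithfulness.  Koma's finite volumes are even boxes with periodic boundary conditions = the tree's tori
`FermionTorus D (2k)`; the model is taken in Lieb's frame (`hamiltonianC`, unitarily equivalent to the printed
(2.1)–(2.9) by the orbital phase automorphism, `KomaPiFluxPrintedModel.lean`, under which the printed `O` of (2.5)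
becomes `Σ_xΓ²_x`); the torus states are translation-AVERAGED before the limit (`torusAvgExpect`, the tree's
convention for `IsTorusLimitOf`, Bratteli–Robinson I §4.3.1), which is what makes (2.15) hold on every box and
not only asymptotically; "weak*-lim" along subsequences is rendered by the predicates' existential side sequence
and by pointwise convergence on every local algebra `𝔄_Λ`.  Sibling-model statement: NOT a statement about the
Hubbard model.  Three definitions with bodies (`IsSourcedGroundStateLimit`, `IsInfinitesimalFieldGroundState`,
`torusAvgGroundStateExpect`); everything else is PROVED; no named fact.

## References

* [Koma2022] T. Koma, arXiv:2201.13135, §2, (2.4)–(2.6), (2.13)–(2.15); §3 (3.1)–(3.3); §4; Theorem 2.1.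
* [KomaTasaki1993] T. Koma, H. Tasaki, Commun. Math. Phys. 158 (1993) 191–214, Theorem 7.3, (7.11).
* [KomaTasaki1994] T. Koma, H. Tasaki, J. Stat. Phys. 76 (1994) 745–803, §2.3 (infinitesimal field after the
  thermodynamic limit).
* [BratteliRobinsonI1987] O. Bratteli, D. W. Robinson, *OAQSM 1*, 2nd ed., §4.3.1 (invariant states as averages,
  weak-⋆ limit points), Thm. 2.3.15 (weak-⋆ compactness of the state space).
* [ArakiMoriya2003] H. Araki, H. Moriya, Rev. Math. Phys. 15 (2003) 93, §4.1 (the fermion lattice algebra, local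
  algebras, translations, states).
* [Tasaki2020] H. Tasaki, *Physics and Mathematics of Quantum Many-Body Systems*, Springer GTP (2020), App. A.2
  (ground states, projections, traces).
* [KLS1988PRL] T. Kennedy, E. H. Lieb, B. S. Shastry, Phys. Rev. Lett. 61 (1988) 2582, eqs. (4)–(8) (the `d = 2`,
  `T = 0` route behind `groundState_superconductingOrder_two`).
-/

noncomputable section

namespace Literature.MathematicalPhysics.QuantumLattice

open _root_.Matrix Finset Filter Topology HubbardWave0 PairHopRP FermionTorus LiebCutRP WithLp
open Literature.Probability.LatticeModels
open scoped Matrix.Norms.L2Operator InnerProductSpace ComplexConjugate ComplexOrder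

/-! ### §1. Second quantisation and torus translations of the `η`-pairing densities -/

namespace PairHopRP

section Embed

variable {Λ Λ' : Type*} [LinearOrder Λ] [Fintype Λ] [LinearOrder Λ'] [Fintype Λ']

/-- `Γ(φ) Γ⁺_x = Γ⁺_{φ x}`. [cite: ArakiMoriya2003, §4.1 Def. 4.1 (2), Def. 4.3] [cite: Koma2022, (3.1)] -/
theorem fermionEmbed_gammaPlus (φ : Λ ↪ Λ') (x : Λ) : fermionEmbed φ (gammaPlus x) = gammaPlus (φ x) := by
  rw [gammaPlus, map_mul, fermionEmbed_creation, fermionEmbed_creation, gammaPlus]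

/-- `Γ(φ) Γ⁻_x = Γ⁻_{φ x}`. [cite: ArakiMoriya2003, §4.1 Def. 4.1 (2), Def. 4.3] [cite: Koma2022, (3.1)] -/
theorem fermionEmbed_gammaMinus (φ : Λ ↪ Λ') (x : Λ) : fermionEmbed φ (gammaMinus x) = gammaMinus (φ x) := by
  rw [gammaMinus, map_mul, fermionEmbed_annihilation, fermionEmbed_annihilation, gammaMinus]

/-- `Γ(φ) Γ¹_x = Γ¹_{φ x}`. [cite: Koma2022, (3.3)] -/
theorem fermionEmbed_gammaOne (φ : Λ ↪ Λ') (x : Λ) : fermionEmbed φ (gammaOne x) = gammaOne (φ x) := by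
  rw [gammaOne, map_add, fermionEmbed_gammaPlus, fermionEmbed_gammaMinus, gammaOne]

/-- `Γ(φ) Γ²_x = Γ²_{φ x}`. [cite: Koma2022, (3.3)] -/
theorem fermionEmbed_gammaTwo (φ : Λ ↪ Λ') (x : Λ) : fermionEmbed φ (gammaTwo x) = gammaTwo (φ x) := by
  rw [gammaTwo, map_smul, map_sub, fermionEmbed_gammaPlus, fermionEmbed_gammaMinus, gammaTwo]

end Embed

section Translate

variable {D L : ℕ} [NeZero L]

/-- `T_v Γ⁺_x T_v⁻¹ = Γ⁺_{x+v}` on the fermionic torus. [cite: Koma2022, (3.1) and §4 (translation invariance)] -/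
theorem relabel_translate_gammaPlus (v x : TorusSite D L) :
    relabel (Orb.translate v) (gammaPlus (ofTorusSite x)) = gammaPlus (ofTorusSite (x + v)) := by
  rw [gammaPlus, relabel_mul, relabel_translate_creation, relabel_translate_creation, gammaPlus]

/-- `T_v Γ⁻_x T_v⁻¹ = Γ⁻_{x+v}`. [cite: Koma2022, (3.1) and §4] -/
theorem relabel_translate_gammaMinus (v x : TorusSite D L) :
    relabel (Orb.translate v) (gammaMinus (ofTorusSite x)) = gammaMinus (ofTorusSite (x + v)) := by
  rw [gammaMinus, relabel_mul, relabel_translate_annihilation, relabel_translate_annihilation, gammaMinus]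

/-- `T_v Γ¹_x T_v⁻¹ = Γ¹_{x+v}`. [cite: Koma2022, (3.3) and §4] -/
theorem relabel_translate_gammaOne (v x : TorusSite D L) :
    relabel (Orb.translate v) (gammaOne (ofTorusSite x)) = gammaOne (ofTorusSite (x + v)) := by
  rw [gammaOne, relabel_add, relabel_translate_gammaPlus, relabel_translate_gammaMinus, gammaOne]

/-- `T_v Γ²_x T_v⁻¹ = Γ²_{x+v}`. [cite: Koma2022, (3.3) and §4] -/
theorem relabel_translate_gammaTwo (v x : TorusSite D L) :
    relabel (Orb.translate v) (gammaTwo (ofTorusSite x)) = gammaTwo (ofTorusSite (x + v)) := by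
  rw [gammaTwo, relabel_smul, relabel_sub, relabel_translate_gammaPlus, relabel_translate_gammaMinus, gammaTwo]

/-- **The order parameter `O = Σ_xΓ²_x` is translation invariant**: `T_v O T_v⁻¹ = O`. [cite: Koma2022, (2.5), §4] -/
theorem relabel_translate_orderParameter (v : TorusSite D L) :
    relabel (Orb.translate v) (orderParameter : Matrix (Finset (Orb (FermionTorus D L))) _ ℂ) = orderParameter := by
  rw [orderParameter, relabel_sum]
  rw [← Fintype.sum_equiv (equivTorusSite (d := D) (L := L)).symm (fun x => relabel (Orb.translate v)
      (gammaTwo (ofTorusSite x))) _ (fun _ => rfl),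
    ← Fintype.sum_equiv (equivTorusSite (d := D) (L := L)).symm (fun x => gammaTwo (ofTorusSite x)) _ (fun _ => rfl)]
  simp_rw [relabel_translate_gammaTwo]
  exact Fintype.sum_equiv (Equiv.addRight v) _ _ fun _ => rfl

end Translate

end PairHopRP

/-! ### §2. The local order density and its translation average -/

namespace KomaPiFlux

variable {d : ℕ}

/-- Linearity of `ψ ↦ ⟨ψ, Aψ⟩` in the observable over finite sums. [folklore] -/
private theorem expect_sum'' {ι : Type*} [LinearOrder ι] [Fintype ι] {β : Type*} (s : Finset β)
    (X : β → Matrix (Finset ι) (Finset ι) ℂ) (ψ : Fock ι) : expect (∑ b ∈ s, X b) ψ = ∑ b ∈ s, expect (X b) ψ := by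
  simp only [expect, Matrix.sum_mulVec, dotProduct_sum]

/-- **The local order density** of Koma's model at a site `x ∈ ℤ^D`: the on-site `η`-pairing operator
`Γ²_x = i(Γ⁺_x - Γ⁻_x)` as an element of the local CAR algebra `𝔄_{{x}}` (Koma's `o^{(1)}_x`, the density of
the order parameter `O` of (2.5), `= Σ_xΓ²_x` in Lieb's frame). [cite: Koma2022, (2.5), (3.3), (5.59)] -/
def localGammaTwo (x : Site (d + 1)) : FermionOp ({x} : Finset (Site (d + 1))) :=
  gammaTwo (PolySite.pt x (Finset.mem_singleton_self x))

/-- A one-point region always fits into the torus. [folklore] -/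
private theorem injOn_proj_singleton (L : ℕ) (x : Site (d + 1)) :
    Set.InjOn (Torus.proj (d := d + 1) L) ↑({x} : Finset (Site (d + 1))) := by
  rw [Finset.coe_singleton]
  exact Set.injOn_singleton _ _

/-- Pulled back into the torus of side `L`, the local order density at `x` is `Γ²_{x mod L}`.
[cite: Koma2022, (3.3)] -/
theorem fermionEmbed_toTorusEmb_localGammaTwo (L : ℕ) [NeZero L] (x : Site (d + 1))
    (h : Set.InjOn (Torus.proj (d := d + 1) L) ↑({x} : Finset (Site (d + 1)))) :
    fermionEmbed (PolySite.toTorusEmb L h) (localGammaTwo x) = gammaTwo (ofTorusSite (Torus.proj L x)) := by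
  rw [localGammaTwo, fermionEmbed_gammaTwo, PolySite.toTorusEmb_apply, PolySite.ofLex_coe_pt]

/-- `⟨U_vψ, Γ²_{x̄} U_vψ⟩ = ⟨ψ, Γ²_{x̄-v} ψ⟩` (`U_v⋆ Γ²_{x̄} U_v = T_{-v}Γ²_{x̄}`). [cite: Koma2022, §4] -/
theorem expect_gammaTwo_fockTranslate_mulVec {L : ℕ} [NeZero L] (v xbar : TorusSite (d + 1) L)
    (ψ : Fock (Orb (FermionTorus (d + 1) L))) :
    expect (gammaTwo (ofTorusSite xbar)) ((fockTranslate v).val *ᵥ ψ) =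
      expect (gammaTwo (ofTorusSite (xbar + -v))) ψ := by
  rw [expect_fockRelabel_mulVec, ← Equiv.Perm.inv_def, ← Orb.translate_neg, relabel_translate_gammaTwo]

/-- `Σ_v ⟨ψ, Γ²_{x̄-v}ψ⟩ = ⟨ψ, (Σ_yΓ²_y)ψ⟩ = ⟨ψ, Oψ⟩`. [cite: Koma2022, (2.5)] -/
theorem sum_expect_gammaTwo_translate {L : ℕ} [NeZero L] (xbar : TorusSite (d + 1) L)
    (ψ : Fock (Orb (FermionTorus (d + 1) L))) :
    ∑ v : TorusSite (d + 1) L, expect (gammaTwo (ofTorusSite (xbar + -v))) ψ = expect orderParameter ψ := by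
  rw [orderParameter, expect_sum'']
  exact Fintype.sum_equiv (((Equiv.neg _).trans (Equiv.addLeft xbar)).trans
    (equivTorusSite (d := d + 1) (L := L)).symm) _ _ fun _ => rfl

/-- **The translation-averaged torus expectation of the local order density is the order parameter per
site**: `torusAvgExpect L {x} Γ²_x ψ = |Λ|⁻¹ ⟨ψ, OΨ⟩` with `O = Σ_{y ∈ Λ}Γ²_y`, `|Λ| = L^D`, for EVERY torus vector
`ψ` (no translation invariance of `ψ` is needed). [cite: Koma2022, (2.5), (2.15)] [cite: BratteliRobinsonI1987, §4.3.1] -/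
theorem torusAvgExpect_localGammaTwo (L : ℕ) [NeZero L] (x : Site (d + 1)) (ψ : Fock (Orb (FermionTorus (d + 1) L))) :
    torusAvgExpect L {x} (localGammaTwo x) ψ =
      ((Fintype.card (FermionTorus (d + 1) L) : ℂ))⁻¹ * expect orderParameter ψ := by
  rw [torusAvgExpect_eq, torusAvgExpectAt_of_injOn L (injOn_proj_singleton L x),
    fermionEmbed_toTorusEmb_localGammaTwo, Fintype.card_congr (equivTorusSite (d := d + 1) (L := L))]
  simp_rw [expect_gammaTwo_fockTranslate_mulVec]
  rw [sum_expect_gammaTwo_translate]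

/-- Inside a region `Λ ∋ x`, the on-site `Γ²` at the ordered site over `x` is the image of the local order
density under isotony. [cite: ArakiMoriya2003, §4.1 Def. 4.1 (2)] -/
theorem fermionEmbed_incl_localGammaTwo {Λ : Finset (Site (d + 1))} (y : PolySite Λ) :
    fermionEmbed (PolySite.incl (Finset.singleton_subset_iff.2 (PolySite.ofLex_mem y))) (localGammaTwo (ofLex y.1)) =
      (gammaTwo y : FermionOp Λ) := by
  rw [localGammaTwo, fermionEmbed_gammaTwo, PolySite.incl_pt, PolySite.pt_ofLex]

/-- **`ω(O^{(Λ)}) = Σ_{x ∈ Λ} ω(Γ²_x)`** for every infinite-volume state and every finite region `Λ`, where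
`O^{(Λ)} = Σ_{x∈Λ}Γ²_x ∈ 𝔄_Λ` is `PairHopRP.orderParameter` of the region (compatibility of the local
functionals along `{x} ⊆ Λ`). [cite: Koma2022, (2.5), (2.15)] [cite: ArakiMoriya2003, §4.1 Def. 4.1] -/
theorem expect_orderParameter_eq_sum (ω : InfVolFermionState (d + 1)) (Λ : Finset (Site (d + 1))) :
    ω.expect Λ (orderParameter : FermionOp Λ) = ∑ x ∈ Λ.attach, ω.expect {x.1} (localGammaTwo x.1) := by
  rw [orderParameter, map_sum]
  let e : PolySite Λ ≃ {x // x ∈ Λ} :=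
    ⟨fun a => ⟨ofLex a.1, PolySite.ofLex_mem a⟩, fun x => PolySite.pt x.1 x.2, fun a => PolySite.pt_ofLex a,
      fun x => Subtype.ext rfl⟩
  rw [← Finset.univ_eq_attach]
  refine Fintype.sum_equiv e _ _ fun y => ?_
  rw [← fermionEmbed_incl_localGammaTwo y, ω.compatible]
  rfl

/-- `O^{(Λ)}` is Hermitian, so `ω(O^{(Λ)})` is real. [cite: Koma2022, (2.5)] -/
theorem expect_orderParameter_im (ω : InfVolFermionState (d + 1)) (Λ : Finset (Site (d + 1))) :
    (ω.expect Λ (orderParameter : FermionOp Λ)).im = 0 :=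
  ω.expect_im_eq_zero_of_isHermitian orderParameter_isHermitian

/-! ### §3. Sourced ground-state limits, the infinitesimal-field states, and the engine -/

attribute [local instance] LiebCutRP.decEqTorus

/-- **`ω` is an infinite-volume SOURCED GROUND STATE of Koma's model at field `B`** — the inner limit of
(2.14) applied to (2.13): there are sides `2k_j` with `k_j → ∞`, and on each even torus `(ℤ/2k_jℤ)^D` a finite
mixture (real weights `p ≥ 0`, `Σ_i p_i = 1`) of unit ground states `ψ_i` of
`H_C(B) = hamiltonianC κ U g g' 0 B = H_C - B·Σ_xΓ²_x` (Lieb frame), such that `ω` is the thermodynamic limit of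
the translation-averaged mixtures (`IsTorusLimitOfMixture`).  The vector ground states are the one-component
mixtures; the zero-temperature limit `lim_{β↗∞}⟨⋯⟩_{β,B}` of (2.13) is the uniform mixture over an orthonormal
basis of the ground space. [cite: Koma2022, (2.13)–(2.14)] [cite: BratteliRobinsonI1987, §4.3.1] -/
def IsSourcedGroundStateLimit (κ U g g' B : ℝ) (ω : InfVolFermionState (d + 1)) : Prop :=
  ∃ (k : ℕ → ℕ) (m : ℕ → ℕ) (p : ∀ L, Fin (m L) → ℝ)
    (ψ : ∀ L, Fin (m L) → Fock (Orb (FermionTorus (d + 1) L))),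
    Tendsto k atTop atTop ∧ (∀ L i, 0 ≤ p L i) ∧ (∀ j, ∑ i, p (2 * k j) i = 1) ∧
    (∀ j i, ∀ [NeZero (2 * k j)],
      star (ψ (2 * k j) i) ⬝ᵥ ψ (2 * k j) i = 1 ∧
        hamiltonianC κ U g g' (fun (_ _ : FermionTorus (d + 1) (2 * k j)) => (0 : ℝ)) B *ᵥ ψ (2 * k j) i =
          ((hamiltonianC κ U g g' (fun (_ _ : FermionTorus (d + 1) (2 * k j)) => (0 : ℝ)) B).groundEnergy : ℂ) •
            ψ (2 * k j) i) ∧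
    ω.IsTorusLimitOfMixture m p ψ (fun j => 2 * k j)

/-- **Koma's `ω_{0,g'}`** (2.14): an infinite-volume state obtained from sourced ground-state limits `ω_n` at
fields `B_n > 0`, `B_n → 0`, as a weak-⋆ limit — pointwise convergence `ω_{n,Λ}(A) → ω_Λ(A)` on every local
algebra `𝔄_Λ` ("the state obtained by applying the infinitesimal symmetry-breaking field AFTER the thermodynamic
limit"). [cite: Koma2022, (2.14)] [cite: KomaTasaki1994, §2.3] -/
def IsInfinitesimalFieldGroundState (κ U g g' : ℝ) (ω : InfVolFermionState (d + 1)) : Prop :=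
  ∃ (B : ℕ → ℝ) (ωB : ℕ → InfVolFermionState (d + 1)),
    (∀ n, 0 < B n) ∧ Tendsto B atTop (𝓝 0) ∧ (∀ n, IsSourcedGroundStateLimit κ U g g' (B n) (ωB n)) ∧
    ∀ (Λ : Finset (Site (d + 1))) (A : FermionOp Λ), Tendsto (fun n => (ωB n).expect Λ A) atTop (𝓝 (ω.expect Λ A))

/-- Vector torus limits of unit ground states are sourced ground-state limits (one-component mixtures).
[cite: Koma2022, (2.13)–(2.14)] -/
theorem IsSourcedGroundStateLimit.of_isTorusLimitOf {κ U g g' B : ℝ} {k : ℕ → ℕ} (hk : Tendsto k atTop atTop)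
    {ψ : ∀ L, Fock (Orb (FermionTorus (d + 1) L))}
    (hψ : ∀ j, ∀ [NeZero (2 * k j)],
      star (ψ (2 * k j)) ⬝ᵥ ψ (2 * k j) = 1 ∧
        hamiltonianC κ U g g' (fun (_ _ : FermionTorus (d + 1) (2 * k j)) => (0 : ℝ)) B *ᵥ ψ (2 * k j) =
          ((hamiltonianC κ U g g' (fun (_ _ : FermionTorus (d + 1) (2 * k j)) => (0 : ℝ)) B).groundEnergy : ℂ) •
            ψ (2 * k j))
    {ω : InfVolFermionState (d + 1)} (hω : ω.IsTorusLimitOf ψ (fun j => 2 * k j)) :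
    IsSourcedGroundStateLimit κ U g g' B ω :=
  ⟨k, fun _ => 1, fun _ _ => 1, fun L _ => ψ L, hk, fun _ _ => zero_le_one, fun _ => by simp,
    fun j _ _ => hψ j, hω.isTorusLimitOfMixture⟩

/-- Sourced ground-state limits are translation invariant. [cite: BratteliRobinsonI1987, §4.3.1] -/
theorem IsSourcedGroundStateLimit.isTranslationInvariant {κ U g g' B : ℝ} {ω : InfVolFermionState (d + 1)}
    (h : IsSourcedGroundStateLimit κ U g g' B ω) : ω.IsTranslationInvariant := by
  obtain ⟨_, _, _, _, -, -, -, -, hω⟩ := h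
  exact hω.isTranslationInvariant

/-- A weighted average with probability weights of numbers `≥ c` is `≥ c`. [folklore] -/
private theorem le_sum_mul_of_forall_le {m : ℕ} {p : Fin m → ℝ} (hp0 : ∀ i, 0 ≤ p i) (hp1 : ∑ i, p i = 1)
    {f : Fin m → ℝ} {c : ℝ} (hf : ∀ i, c ≤ f i) : c ≤ ∑ i, p i * f i := by
  calc c = ∑ i, p i * c := by rw [← Finset.sum_mul, hp1, one_mul]
    _ ≤ ∑ i, p i * f i := Finset.sum_le_sum fun i _ => mul_le_mul_of_nonneg_left (hf i) (hp0 i)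

/-- **ENGINE, infinite volume.**  If the symmetric ground states have long-range order `groundLroSq H_C(0) ≥ a`,
`0 < a ≤ 1`, on all large even tori, then at EVERY site `x ∈ ℤ^D` every sourced ground-state limit `ω` at any
field `B > 0` has `Re ω(Γ²_x) ≥ √(2a)` (`= √2σ`): the translation-averaged expectation of `Γ²_x` in a mixture of
unit ground states on the `2k_j`-torus is the mixture of the `|Λ|⁻¹ Re Φ†OΦ ≥ √(2a) - ε`
(`spontaneousOrder_of_groundLroSq`, `torusAvgExpect_localGammaTwo`), for every `ε > 0` eventually in `j`.
[cite: Koma2022, (2.15)] [cite: KomaTasaki1993, Theorem 7.3, (7.11)] -/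
theorem IsSourcedGroundStateLimit.le_re_expect_localGammaTwo_of_groundLroSq {κ U g g' a : ℝ} (ha : 0 < a)
    (ha1 : a ≤ 1) {k₀ : ℕ}
    (hlro : ∀ k : ℕ, k₀ ≤ k → ∀ [NeZero (2 * k)],
      a ≤ groundLroSq (hamiltonianC κ U g g' (fun (_ _ : FermionTorus (d + 1) (2 * k)) => (0 : ℝ)) 0))
    {B : ℝ} (hB : 0 < B) {ω : InfVolFermionState (d + 1)} (hω : IsSourcedGroundStateLimit κ U g g' B ω)
    (x : Site (d + 1)) : Real.sqrt (2 * a) ≤ (ω.expect {x} (localGammaTwo x)).re := by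
  obtain ⟨k, m, p, ψ, hk, hp0, hp1, hψ, hlim⟩ := hω
  have hre : Tendsto (fun j => (∑ i, (p (2 * k j) i : ℂ) * torusAvgExpect (2 * k j) {x} (localGammaTwo x)
      (ψ (2 * k j) i)).re) atTop (𝓝 (ω.expect {x} (localGammaTwo x)).re) :=
    (Complex.continuous_re.tendsto _).comp (hlim {x} (localGammaTwo x))
  refine le_of_forall_pos_le_add fun ε hε => ?_
  obtain ⟨k₁, hk₁⟩ := spontaneousOrder_of_groundLroSq ha ha1 hlro hB hε
  have hev : ∀ᶠ j in atTop, Real.sqrt (2 * a) - ε ≤ (∑ i, (p (2 * k j) i : ℂ) *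
      torusAvgExpect (2 * k j) {x} (localGammaTwo x) (ψ (2 * k j) i)).re := by
    filter_upwards [hk.eventually_ge_atTop (max k₁ 1)] with j hj
    haveI : NeZero (2 * k j) := ⟨by omega⟩
    have hterm : ∀ i, ((p (2 * k j) i : ℂ) * torusAvgExpect (2 * k j) {x} (localGammaTwo x) (ψ (2 * k j) i)).re =
        p (2 * k j) i * ((star (ψ (2 * k j) i) ⬝ᵥ (orderParameter *ᵥ ψ (2 * k j) i)).re /
          (Fintype.card (FermionTorus (d + 1) (2 * k j)) : ℝ)) := by
      intro i
      rw [torusAvgExpect_localGammaTwo, ← Complex.ofReal_natCast, ← Complex.ofReal_inv, ← mul_assoc,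
        ← Complex.ofReal_mul, Complex.re_ofReal_mul, expect, div_eq_inv_mul, mul_assoc]
    rw [Complex.re_sum]
    simp_rw [hterm]
    exact le_sum_mul_of_forall_le (fun i => hp0 _ i) (hp1 j) fun i =>
      hk₁ (k j) (le_trans (le_max_left _ _) hj) (ψ (2 * k j) i) (hψ j i).1 (hψ j i).2
  have := ge_of_tendsto hre hev
  linarith

/-- The site bound passes to the infinitesimal-field states (a closed condition under pointwise convergence).
[cite: Koma2022, (2.14)–(2.15)] -/
theorem IsInfinitesimalFieldGroundState.le_re_expect_localGammaTwo_of_groundLroSq {κ U g g' a : ℝ} (ha : 0 < a)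
    (ha1 : a ≤ 1) {k₀ : ℕ}
    (hlro : ∀ k : ℕ, k₀ ≤ k → ∀ [NeZero (2 * k)],
      a ≤ groundLroSq (hamiltonianC κ U g g' (fun (_ _ : FermionTorus (d + 1) (2 * k)) => (0 : ℝ)) 0))
    {ω : InfVolFermionState (d + 1)} (hω : IsInfinitesimalFieldGroundState κ U g g' ω) (x : Site (d + 1)) :
    Real.sqrt (2 * a) ≤ (ω.expect {x} (localGammaTwo x)).re := by
  obtain ⟨B, ωB, hB, -, hGS, hlim⟩ := hω
  exact ge_of_tendsto ((Complex.continuous_re.tendsto _).comp (hlim {x} (localGammaTwo x)))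
    (Eventually.of_forall fun n => (hGS n).le_re_expect_localGammaTwo_of_groundLroSq ha ha1 hlro (hB n) x)

/-- **Box form**: a uniform site bound `Re ω(Γ²_x) ≥ μ` sums to `μ·|Λ| ≤ Re ω(O^{(Λ)})` on every finite region.
[cite: Koma2022, (2.15)] -/
theorem boxOrder_ge_of_forall_site {μ : ℝ} {ω : InfVolFermionState (d + 1)}
    (h : ∀ x : Site (d + 1), μ ≤ (ω.expect {x} (localGammaTwo x)).re) (Λ : Finset (Site (d + 1))) :
    μ * Λ.card ≤ (ω.expect Λ (orderParameter : FermionOp Λ)).re := by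
  rw [expect_orderParameter_eq_sum, Complex.re_sum]
  calc μ * Λ.card = ∑ _x ∈ Λ.attach, μ := by rw [Finset.sum_const, Finset.card_attach, nsmul_eq_mul, mul_comm]
    _ ≤ ∑ x ∈ Λ.attach, (ω.expect {x.1} (localGammaTwo x.1)).re := Finset.sum_le_sum fun x _ => h x.1

/-- **ENGINE, (2.15) form**: `groundLroSq H_C(0) ≥ a ∈ (0,1]` on all large even tori ⟹ every infinitesimal-field
ground state has `√(2a)·|Λ| ≤ Re ω(O^{(Λ)})` for EVERY finite region `Λ ⊂ ℤ^D`.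
[cite: Koma2022, (2.15)] [cite: KomaTasaki1993, Theorem 7.3] -/
theorem IsInfinitesimalFieldGroundState.boxOrder_ge_of_groundLroSq {κ U g g' a : ℝ} (ha : 0 < a) (ha1 : a ≤ 1)
    {k₀ : ℕ}
    (hlro : ∀ k : ℕ, k₀ ≤ k → ∀ [NeZero (2 * k)],
      a ≤ groundLroSq (hamiltonianC κ U g g' (fun (_ _ : FermionTorus (d + 1) (2 * k)) => (0 : ℝ)) 0))
    {ω : InfVolFermionState (d + 1)} (hω : IsInfinitesimalFieldGroundState κ U g g' ω) (Λ : Finset (Site (d + 1))) :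
    Real.sqrt (2 * a) * Λ.card ≤ (ω.expect Λ (orderParameter : FermionOp Λ)).re :=
  boxOrder_ge_of_forall_site (fun x => hω.le_re_expect_localGammaTwo_of_groundLroSq ha ha1 hlro x) Λ

/-- The same box bound for the sourced ground-state limits themselves (before `B ↘ 0`). [cite: Koma2022, (2.15)] -/
theorem IsSourcedGroundStateLimit.boxOrder_ge_of_groundLroSq {κ U g g' a : ℝ} (ha : 0 < a) (ha1 : a ≤ 1)
    {k₀ : ℕ}
    (hlro : ∀ k : ℕ, k₀ ≤ k → ∀ [NeZero (2 * k)],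
      a ≤ groundLroSq (hamiltonianC κ U g g' (fun (_ _ : FermionTorus (d + 1) (2 * k)) => (0 : ℝ)) 0))
    {B : ℝ} (hB : 0 < B) {ω : InfVolFermionState (d + 1)} (hω : IsSourcedGroundStateLimit κ U g g' B ω)
    (Λ : Finset (Site (d + 1))) :
    Real.sqrt (2 * a) * Λ.card ≤ (ω.expect Λ (orderParameter : FermionOp Λ)).re :=
  boxOrder_ge_of_forall_site (fun x => hω.le_re_expect_localGammaTwo_of_groundLroSq ha ha1 hlro hB x) Λ

/-! ### §4. Koma 2022 (2.15) for the model of Theorem 2.1 (`D ≥ 3`, Coulomb `g'`) and in two dimensions -/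

/-- **Koma 2022 eq. (2.15), `D = d+1 ≥ 3`.**  For `g > 0`, `|κ| ≤ g/1000`, `0 ≤ g' ≤ g/2000`, `U + 2gD ≤ 0`, every
state `ω_{0,g'}` of (2.14) — weak-⋆ limit as `B ↘ 0` of thermodynamic limits of (mixtures of) ground states of
`H_C - B·O` on even tori — has the spontaneous superconducting order
`|Λ|⁻¹ Re ω_{0,g'}(O^{(Λ)}) ≥ 1/√1000` on EVERY finite region `Λ ⊂ ℤ^D` (`O^{(Λ)} = Σ_{x∈Λ}Γ²_x`; `μ = √2σ`,
`σ² = 1/2000` from `groundState_superconductingOrder_coulomb`). [cite: Koma2022, (2.15)] [cite: KomaTasaki1993, Theorem 7.3] -/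
theorem IsInfinitesimalFieldGroundState.boxOrder_ge_coulomb (hd : 2 ≤ d) {κ U g g' : ℝ} (hg : 0 < g)
    (hκg : |κ| ≤ g / 1000) (hg'0 : 0 ≤ g') (hg'g : g' ≤ g / 2000) (hU : U + 2 * g * (d + 1) ≤ 0)
    {ω : InfVolFermionState (d + 1)} (hω : IsInfinitesimalFieldGroundState κ U g g' ω) (Λ : Finset (Site (d + 1))) :
    1 / Real.sqrt 1000 * Λ.card ≤ (ω.expect Λ (orderParameter : FermionOp Λ)).re := by
  obtain ⟨k₀, hk₀⟩ := groundState_superconductingOrder_coulomb hd hg hκg hg'0 hg'g hU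
  rw [← sqrt_two_div_two_thousand]
  exact hω.boxOrder_ge_of_groundLroSq (by norm_num) (by norm_num) hk₀ Λ

/-- (2.15) at a single site, `D ≥ 3`: `Re ω_{0,g'}(Γ²_x) ≥ 1/√1000`. [cite: Koma2022, (2.15)] -/
theorem IsInfinitesimalFieldGroundState.le_re_expect_localGammaTwo_coulomb (hd : 2 ≤ d) {κ U g g' : ℝ}
    (hg : 0 < g) (hκg : |κ| ≤ g / 1000) (hg'0 : 0 ≤ g') (hg'g : g' ≤ g / 2000) (hU : U + 2 * g * (d + 1) ≤ 0)
    {ω : InfVolFermionState (d + 1)} (hω : IsInfinitesimalFieldGroundState κ U g g' ω) (x : Site (d + 1)) :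
    1 / Real.sqrt 1000 ≤ (ω.expect {x} (localGammaTwo x)).re := by
  obtain ⟨k₀, hk₀⟩ := groundState_superconductingOrder_coulomb hd hg hκg hg'0 hg'g hU
  rw [← sqrt_two_div_two_thousand]
  exact hω.le_re_expect_localGammaTwo_of_groundLroSq (by norm_num) (by norm_num) hk₀ x

/-- (2.15) already for the sourced ground-state limits at fixed `B > 0`, `D ≥ 3`. [cite: Koma2022, (2.15)] -/
theorem IsSourcedGroundStateLimit.boxOrder_ge_coulomb (hd : 2 ≤ d) {κ U g g' : ℝ} (hg : 0 < g)
    (hκg : |κ| ≤ g / 1000) (hg'0 : 0 ≤ g') (hg'g : g' ≤ g / 2000) (hU : U + 2 * g * (d + 1) ≤ 0) {B : ℝ}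
    (hB : 0 < B) {ω : InfVolFermionState (d + 1)} (hω : IsSourcedGroundStateLimit κ U g g' B ω)
    (Λ : Finset (Site (d + 1))) :
    1 / Real.sqrt 1000 * Λ.card ≤ (ω.expect Λ (orderParameter : FermionOp Λ)).re := by
  obtain ⟨k₀, hk₀⟩ := groundState_superconductingOrder_coulomb hd hg hκg hg'0 hg'g hU
  rw [← sqrt_two_div_two_thousand]
  exact hω.boxOrder_ge_of_groundLroSq (by norm_num) (by norm_num) hk₀ hB Λ

/-- **(2.15) in two dimensions at zero temperature** (`D = 2`, `hamiltonian κ U g 0 B = hamiltonianC κ U g 0 0 B`):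
for `g > 0`, `|κ| ≤ g/2000`, `U + 4g ≤ 0`, every infinitesimal-field ground state has
`|Λ|⁻¹ Re ω(O^{(Λ)}) ≥ 4/√1000` on every finite region (`σ² = 1/125`, `groundState_superconductingOrder_two`).
[cite: Koma2022, (2.15)] [cite: KLS1988PRL, eqs. (4)–(8)] [cite: KomaTasaki1993, Theorem 7.3] -/
theorem IsInfinitesimalFieldGroundState.boxOrder_ge_two {κ U g : ℝ} (hg : 0 < g) (hκg : |κ| ≤ g / 2000)
    (hU : U + 4 * g ≤ 0) {ω : InfVolFermionState (1 + 1)} (hω : IsInfinitesimalFieldGroundState κ U g 0 ω)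
    (Λ : Finset (Site (1 + 1))) :
    4 / Real.sqrt 1000 * Λ.card ≤ (ω.expect Λ (orderParameter : FermionOp Λ)).re := by
  obtain ⟨k₀, hk₀⟩ := groundState_superconductingOrder_two hg hκg hU
  have hlro : ∀ k : ℕ, k₀ ≤ k → ∀ [NeZero (2 * k)],
      (1 / 125 : ℝ) ≤ groundLroSq (hamiltonianC κ U g 0 (fun (_ _ : FermionTorus (1 + 1) (2 * k)) => (0 : ℝ)) 0) :=
    fun k hk _ => by rw [hamiltonianC_zero]; exact hk₀ k hk
  rw [← sqrt_two_div_125]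
  exact hω.boxOrder_ge_of_groundLroSq (by norm_num) (by norm_num) hlro Λ

/-! ### Non-vacuity: the subsequences of (2.14) exist -/

/-- On every nonempty finite index type a Hermitian matrix has a unit ground-state vector. [cite: Tasaki2020, App. A.2] -/
private theorem exists_unit_groundState {n : Type*} [Fintype n] [DecidableEq n] [Nonempty n] {A : Matrix n n ℂ}
    (hA : A.IsHermitian) : ∃ Φ : n → ℂ, star Φ ⬝ᵥ Φ = 1 ∧ A *ᵥ Φ = (A.groundEnergy : ℂ) • Φ := by
  obtain ⟨Φ, hΦ, hAΦ, -, -⟩ := Matrix.exists_groundState_eigenvector_re_ge hA hA rfl A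
  exact ⟨Φ, hΦ, hAΦ⟩

/-- **Sourced ground-state limits exist** at every field: choosing a unit ground state of `H_C(B)` on each even
torus, a subsequence of the translation-averaged states converges (weak-⋆ compactness,
`InfVolFermionState.exists_isTorusLimitOf_subseq`). [cite: Koma2022, (2.14)] [cite: BratteliRobinsonI1987, Thm. 2.3.15] -/
theorem exists_isSourcedGroundStateLimit (κ U g g' B : ℝ) :
    ∃ ω : InfVolFermionState (d + 1), IsSourcedGroundStateLimit κ U g g' B ω := by
  classical
  -- a unit ground state on every torus of side `L ≠ 0` (junk `0` at `L = 0`)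
  have hGS : ∀ L : ℕ, ∃ Φ : Fock (Orb (FermionTorus (d + 1) L)), ∀ [NeZero L],
      star Φ ⬝ᵥ Φ = 1 ∧
        hamiltonianC κ U g g' (fun (_ _ : FermionTorus (d + 1) L) => (0 : ℝ)) B *ᵥ Φ =
          ((hamiltonianC κ U g g' (fun (_ _ : FermionTorus (d + 1) L) => (0 : ℝ)) B).groundEnergy : ℂ) • Φ := by
    intro L
    by_cases hL : L = 0
    · exact ⟨0, absurd hL (NeZero.ne L)⟩
    · haveI : NeZero L := ⟨hL⟩
      obtain ⟨Φ, hΦ, hHΦ⟩ := exists_unit_groundState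
        (hamiltonianC_isHermitian κ U g g' (fun (_ _ : FermionTorus (d + 1) L) => (0 : ℝ)) B)
      exact ⟨Φ, ⟨hΦ, hHΦ⟩⟩
  choose ψ hψ using hGS
  have hLs : Tendsto (fun j : ℕ => 2 * (j + 1)) atTop atTop :=
    Filter.tendsto_atTop_atTop.2 fun b => ⟨b, fun j hj => by omega⟩
  have hunit : ∀ j : ℕ, star (ψ (2 * (j + 1))) ⬝ᵥ ψ (2 * (j + 1)) = 1 := fun j => by
    haveI : NeZero (2 * (j + 1)) := ⟨by omega⟩
    exact (hψ (2 * (j + 1))).1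
  obtain ⟨φ, hφ, ω, hω⟩ := InfVolFermionState.exists_isTorusLimitOf_subseq ψ hLs hunit
  refine ⟨ω, IsSourcedGroundStateLimit.of_isTorusLimitOf (k := fun j => φ j + 1)
    ((tendsto_add_atTop_nat 1).comp hφ.tendsto_atTop |>.congr fun j => rfl) (fun j _ => hψ _) ?_⟩
  exact hω.congr (Eventually.of_forall fun j => rfl)

/-- **Koma's states `ω_{0,g'}` of (2.14) exist**: take sourced ground-state limits at `B_n = 1/(n+1)` and a weak-⋆
convergent subsequence (`InfVolFermionState.exists_tendsto_expect_subseq`). [cite: Koma2022, (2.14)]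
[cite: BratteliRobinsonI1987, Thm. 2.3.15] -/
theorem exists_isInfinitesimalFieldGroundState (κ U g g' : ℝ) :
    ∃ ω : InfVolFermionState (d + 1), IsInfinitesimalFieldGroundState κ U g g' ω := by
  choose ωB hωB using fun n : ℕ => exists_isSourcedGroundStateLimit (d := d) κ U g g' (1 / ((n : ℝ) + 1))
  obtain ⟨φ, hφ, ω, hω⟩ := InfVolFermionState.exists_tendsto_expect_subseq ωB
  refine ⟨ω, fun n => 1 / ((φ n : ℝ) + 1), fun n => ωB (φ n), fun n => by positivity, ?_, fun n => hωB (φ n), hω⟩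
  exact tendsto_one_div_add_atTop_nhds_zero_nat.comp hφ.tendsto_atTop

/-! ### §5. The zero-temperature limit states (2.13) are mixtures of ground states -/

end KomaPiFlux

section General

variable {n : Type*} [Fintype n] [DecidableEq n]

/-- **The tracial ground state is the uniform mixture over an orthonormal basis of the ground space**: for a
Hermitian `A` on a nonempty index type there are `m ≥ 1` unit ground-state vectors `e_1,…,e_m` (an orthonormal
basis of the ground space) with `ω_GS(O) = m⁻¹ Σ_i e_i†Oe_i` for EVERY matrix `O`
(`ω_GS = groundStateFunctional A = tr(P₀ ·)/tr P₀`). [cite: Tasaki2020, App. A.2] [cite: Koma2022, (2.13)] -/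
theorem _root_.Matrix.exists_groundStateFunctional_eq_average [Nonempty n] {A : Matrix n n ℂ} (hA : A.IsHermitian) :
    ∃ (m : ℕ) (e : Fin m → n → ℂ), 0 < m ∧
      (∀ i, star (e i) ⬝ᵥ e i = 1 ∧ A *ᵥ e i = (A.groundEnergy : ℂ) • e i) ∧
      ∀ O : Matrix n n ℂ, A.groundStateFunctional O = ((m : ℂ))⁻¹ * ∑ i, star (e i) ⬝ᵥ (O *ᵥ e i) := by
  set K : Submodule ℂ (EuclideanSpace ℂ n) :=
    A.groundSpace.map ((WithLp.linearEquiv 2 ℂ (n → ℂ)).symm : (n → ℂ) →ₗ[ℂ] EuclideanSpace ℂ n) with hK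
  have hPK : A.groundProj = projMatrix K := groundProj_eq A
  have hmemK : ∀ v : EuclideanSpace ℂ n, v ∈ K ↔ (ofLp v : n → ℂ) ∈ A.groundSpace := by
    intro v
    rw [hK, Submodule.mem_map]
    constructor
    · rintro ⟨u, hu, huv⟩
      rw [← huv]
      exact hu
    · intro hv
      exact ⟨ofLp v, hv, rfl⟩
  have hKne : K ≠ ⊥ := by
    intro hbot
    apply groundSpace_ne_bot_holds hA
    rw [Submodule.eq_bot_iff] at hbot ⊢
    intro v hv
    have h := hbot (toLp 2 v) ((hmemK _).2 hv)
    have h' := congrArg ofLp h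
    simpa using h'
  set m : ℕ := Module.finrank ℂ K with hm_def
  have hm0 : m ≠ 0 := fun h => hKne (Submodule.finrank_eq_zero.1 h)
  let b : OrthonormalBasis (Fin m) ℂ K := stdOrthonormalBasis ℂ K
  have hnorm : ∀ i, ‖(b i : EuclideanSpace ℂ n)‖ = 1 := fun i => by
    have h1 : ‖b i‖ = 1 := b.orthonormal.1 i
    exact h1
  have htr1 : A.groundProj.trace = (m : ℂ) := by
    have h := trace_projMatrix_mul_eq_sum K b 1
    rw [Matrix.mul_one, map_one] at h
    rw [hPK, h]
    simp only [ContinuousLinearMap.one_def, ContinuousLinearMap.coe_id', id_eq, inner_self_eq_norm_sq_to_K, hnorm,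
      Finset.sum_const, Finset.card_univ, Fintype.card_fin, hm_def]
    simp
  refine ⟨m, fun i => ofLp (b i : EuclideanSpace ℂ n), Nat.pos_of_ne_zero hm0, fun i => ⟨?_, ?_⟩, fun O => ?_⟩
  · rw [star_ofLp_dotProduct_ofLp, hnorm, one_pow, Complex.ofReal_one]
  · exact (mem_groundSpace_iff A _).1 ((hmemK _).1 (b i).2)
  · rw [groundStateFunctional_apply, htr1, hPK, trace_projMatrix_mul_eq_sum K b O]
    simp_rw [inner_toEuclideanCLM_eq_dotProduct]

end General

namespace KomaPiFlux

variable {d : ℕ}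

attribute [local instance] LiebCutRP.decEqTorus

/-- **The translation-averaged zero-temperature expectation** of a local observable `A ∈ 𝔄_Λ` on the torus
of side `L`: `|Λ_L|⁻¹ Σ_v ω_GS(U_v⋆ Γ(A) U_v)` with `ω_GS = groundStateFunctional H` the tracial ground state of
`H` — by `Matrix.tendsto_gibbsState_atTop_holds` this is the `β ↗ ∞` limit (2.13) of the translation-averaged Gibbs
expectations (`tendsto_gibbsState_torusAvg`); junk value `0` when `Λ` does not fit into the torus (as for
`torusAvgExpect`). [cite: Koma2022, (2.13)] [cite: BratteliRobinsonI1987, §4.3.1] -/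
def torusAvgGroundStateExpect (L : ℕ) [NeZero L]
    (H : Matrix (Finset (Orb (FermionTorus (d + 1) L))) (Finset (Orb (FermionTorus (d + 1) L))) ℂ)
    (Λ : Finset (Site (d + 1))) (A : FermionOp Λ) : ℂ :=
  if h : Set.InjOn (Torus.proj (d := d + 1) L) ↑Λ then
    ((Fintype.card (TorusSite (d + 1) L) : ℂ))⁻¹ *
      ∑ v : TorusSite (d + 1) L,
        H.groundStateFunctional (relabel (Orb.translate v).symm (fermionEmbed (PolySite.toTorusEmb L h) A))
  else 0

/-- **(2.13)**: for a Hermitian `H` and a region fitting into the torus, the translation-averaged Gibbs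
expectations `|Λ_L|⁻¹ Σ_v ⟨U_v⋆Γ(A)U_v⟩_{β}` converge, as `β ↗ ∞`, to `torusAvgGroundStateExpect L H Λ A`.
[cite: Koma2022, (2.13)] -/
theorem tendsto_gibbsState_torusAvg (L : ℕ) [NeZero L]
    {H : Matrix (Finset (Orb (FermionTorus (d + 1) L))) (Finset (Orb (FermionTorus (d + 1) L))) ℂ}
    (hH : H.IsHermitian) (Λ : Finset (Site (d + 1))) (A : FermionOp Λ)
    (h : Set.InjOn (Torus.proj (d := d + 1) L) ↑Λ) :
    Tendsto (fun β : ℝ => ((Fintype.card (TorusSite (d + 1) L) : ℂ))⁻¹ *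
      ∑ v : TorusSite (d + 1) L,
        H.gibbsState β (relabel (Orb.translate v).symm (fermionEmbed (PolySite.toTorusEmb L h) A)))
      atTop (𝓝 (torusAvgGroundStateExpect L H Λ A)) := by
  rw [torusAvgGroundStateExpect, dif_pos h]
  exact (tendsto_finsetSum _ fun v _ => Matrix.tendsto_gibbsState_atTop_holds hH _).const_mul _

/-- **The zero-temperature limit state (2.13) is a finite mixture of unit ground states with probability
weights**, uniformly in the observable: for Hermitian `H` there are `m ≥ 1` unit ground-state vectors `ψ_i` with
`torusAvgGroundStateExpect L H Λ A = Σ_i m⁻¹ · torusAvgExpect L Λ A ψ_i` for ALL regions `Λ` and ALL `A ∈ 𝔄_Λ`.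
[cite: Koma2022, (2.13)] [cite: Tasaki2020, App. A.2] -/
theorem exists_torusAvgGroundStateExpect_eq_mixture (L : ℕ) [NeZero L]
    {H : Matrix (Finset (Orb (FermionTorus (d + 1) L))) (Finset (Orb (FermionTorus (d + 1) L))) ℂ}
    (hH : H.IsHermitian) :
    ∃ (m : ℕ) (ψ : Fin m → Fock (Orb (FermionTorus (d + 1) L))), 0 < m ∧
      (∀ i, star (ψ i) ⬝ᵥ ψ i = 1 ∧ H *ᵥ ψ i = (H.groundEnergy : ℂ) • ψ i) ∧
      ∀ (Λ : Finset (Site (d + 1))) (A : FermionOp Λ),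
        torusAvgGroundStateExpect L H Λ A = ∑ i, (((m : ℝ)⁻¹ : ℝ) : ℂ) * torusAvgExpect L Λ A (ψ i) := by
  obtain ⟨m, e, hm, he, havg⟩ := Matrix.exists_groundStateFunctional_eq_average hH
  refine ⟨m, e, hm, he, fun Λ A => ?_⟩
  by_cases h : Set.InjOn (Torus.proj (d := d + 1) L) ↑Λ
  · rw [torusAvgGroundStateExpect, dif_pos h]
    simp_rw [torusAvgExpect_eq, torusAvgExpectAt_of_injOn L h, havg, expect_fockRelabel_mulVec, Finset.mul_sum]
    rw [Finset.sum_comm]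
    refine Finset.sum_congr rfl fun i _ => Finset.sum_congr rfl fun v _ => ?_
    rw [expect]
    push_cast
    ring
  · rw [torusAvgGroundStateExpect, dif_neg h]
    simp_rw [torusAvgExpect_eq, torusAvgExpectAt_of_not_injOn L h, mul_zero, Finset.sum_const_zero]

/-- **Koma's (2.13) ⟶ (2.14), inner limit.**  If `ω` is the thermodynamic limit, along even tori `(ℤ/2k_jℤ)^D` with
`k_j ≥ 1`, `k_j → ∞`, of the translation-averaged ZERO-TEMPERATURE LIMIT STATES `lim_{β↗∞}⟨⋯⟩_{β,B}` of
`H_C(B) = hamiltonianC κ U g g' 0 B` (2.13), then `ω` is a sourced ground-state limit at field `B` (the tracial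
ground state of each torus is a probability mixture of unit ground states,
`exists_torusAvgGroundStateExpect_eq_mixture`). [cite: Koma2022, (2.13)–(2.14)] -/
theorem IsSourcedGroundStateLimit.of_zeroTemperature {κ U g g' B : ℝ} {k : ℕ → ℕ} (hk : Tendsto k atTop atTop)
    (hk1 : ∀ j, 0 < k j) {ω : InfVolFermionState (d + 1)}
    (hω : ∀ (Λ : Finset (Site (d + 1))) (A : FermionOp Λ),
      Tendsto (fun j =>
        haveI : NeZero (2 * k j) := ⟨by have := hk1 j; omega⟩
        torusAvgGroundStateExpect (2 * k j)
          (hamiltonianC κ U g g' (fun (_ _ : FermionTorus (d + 1) (2 * k j)) => (0 : ℝ)) B) Λ A)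
        atTop (𝓝 (ω.expect Λ A))) :
    IsSourcedGroundStateLimit κ U g g' B ω := by
  classical
  have hmix : ∀ L : ℕ, ∃ (m : ℕ) (ψ : Fin m → Fock (Orb (FermionTorus (d + 1) L))), 0 < m ∧
      (∀ i, ∀ [NeZero L], star (ψ i) ⬝ᵥ ψ i = 1 ∧
        hamiltonianC κ U g g' (fun (_ _ : FermionTorus (d + 1) L) => (0 : ℝ)) B *ᵥ ψ i =
          ((hamiltonianC κ U g g' (fun (_ _ : FermionTorus (d + 1) L) => (0 : ℝ)) B).groundEnergy : ℂ) • ψ i) ∧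
      ∀ [NeZero L], ∀ (Λ : Finset (Site (d + 1))) (A : FermionOp Λ),
        torusAvgGroundStateExpect L (hamiltonianC κ U g g' (fun (_ _ : FermionTorus (d + 1) L) => (0 : ℝ)) B) Λ A =
          ∑ i, (((m : ℝ)⁻¹ : ℝ) : ℂ) * torusAvgExpect L Λ A (ψ i) := by
    intro L
    by_cases hL : L = 0
    · exact ⟨1, fun _ => 0, one_pos, fun _ _ => absurd hL (NeZero.ne L), fun Λ A => absurd hL (NeZero.ne L)⟩
    · haveI : NeZero L := ⟨hL⟩
      obtain ⟨m, ψ, hm, hψ, hsum⟩ := exists_torusAvgGroundStateExpect_eq_mixture L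
        (hamiltonianC_isHermitian κ U g g' (fun (_ _ : FermionTorus (d + 1) L) => (0 : ℝ)) B)
      exact ⟨m, ψ, hm, fun i _ => hψ i, fun Λ A => hsum Λ A⟩
  choose m ψ hm hGS hsum using hmix
  refine ⟨k, m, fun L _ => (m L : ℝ)⁻¹, ψ, hk, fun L _ => by positivity, fun j => ?_, fun j i _ => hGS _ i, ?_⟩
  · rw [Finset.sum_const, Finset.card_univ, Fintype.card_fin, nsmul_eq_mul,
      mul_inv_cancel₀ (by exact_mod_cast (hm _).ne')]
  · intro Λ A
    refine (hω Λ A).congr fun j => ?_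
    haveI : NeZero (2 * k j) := ⟨by have := hk1 j; omega⟩
    exact hsum (2 * k j) Λ A

/-- **Koma 2022 (2.13)–(2.15) end to end, `D ≥ 3`.**  `g > 0`, `|κ| ≤ g/1000`, `0 ≤ g' ≤ g/2000`, `U + 2gD ≤ 0`;
fields `B_n > 0`, `B_n → 0`; for each `n` a state `ω_n` = thermodynamic limit (even tori, sides `2k_{n,j}`,
`k_{n,j} ≥ 1`, `k_{n,j} → ∞`) of the translation-averaged zero-temperature limit states (2.13) of `H_C(B_n)`; and
`ω_{0,g'}` a weak-⋆ limit of the `ω_n` (2.14).  Then `|Λ|⁻¹ Re ω_{0,g'}(O^{(Λ)}) ≥ 1/√1000` for every finite region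
`Λ ⊂ ℤ^D` (2.15). [cite: Koma2022, (2.13)–(2.15)] [cite: KomaTasaki1993, Theorem 7.3] -/
theorem koma_2_15_coulomb (hd : 2 ≤ d) {κ U g g' : ℝ} (hg : 0 < g) (hκg : |κ| ≤ g / 1000) (hg'0 : 0 ≤ g')
    (hg'g : g' ≤ g / 2000) (hU : U + 2 * g * (d + 1) ≤ 0) {B : ℕ → ℝ} (hB : ∀ n, 0 < B n)
    (hB0 : Tendsto B atTop (𝓝 0)) {kk : ℕ → ℕ → ℕ} (hkk : ∀ n, Tendsto (kk n) atTop atTop)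
    (hkk1 : ∀ n j, 0 < kk n j) {ωB : ℕ → InfVolFermionState (d + 1)}
    (hωB : ∀ n (Λ : Finset (Site (d + 1))) (A : FermionOp Λ),
      Tendsto (fun j =>
        haveI : NeZero (2 * kk n j) := ⟨by have := hkk1 n j; omega⟩
        torusAvgGroundStateExpect (2 * kk n j)
          (hamiltonianC κ U g g' (fun (_ _ : FermionTorus (d + 1) (2 * kk n j)) => (0 : ℝ)) (B n)) Λ A)
        atTop (𝓝 ((ωB n).expect Λ A)))
    {ω : InfVolFermionState (d + 1)}
    (hω : ∀ (Λ : Finset (Site (d + 1))) (A : FermionOp Λ),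
      Tendsto (fun n => (ωB n).expect Λ A) atTop (𝓝 (ω.expect Λ A)))
    (Λ : Finset (Site (d + 1))) :
    1 / Real.sqrt 1000 * Λ.card ≤ (ω.expect Λ (orderParameter : FermionOp Λ)).re :=
  IsInfinitesimalFieldGroundState.boxOrder_ge_coulomb hd hg hκg hg'0 hg'g hU
    ⟨B, ωB, hB, hB0, fun n => IsSourcedGroundStateLimit.of_zeroTemperature (hkk n) (hkk1 n) (hωB n), hω⟩ Λ

end KomaPiFlux

end Literature.MathematicalPhysics.QuantumLattice
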